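import Summits.HodgeConjecture.HodgeCM.Literature.RealApproximation_1

/-! PORT of `HodgeCM/Literature/RealApproximation.lean` (HodgeCMPerL run 82) — part 2: continuation of `Summits.HodgeConjecture.HodgeCM.Literature.RealApproximation_1` (split at a top-level declaration boundary by port_pkg.py; scope re-opened below; declarations unchanged). -/

-- port_pkg: scope re-opened for this part (file-level context, then the namespace/section stack open at the cut)
set_option autoImplicit false
noncomputable section
open NumberField NumberField.InfinitePlace Topology Matrix
open Literature.AlgebraicGeometry.ShimuraVarieties
namespace HodgeCM.Literature
namespace RealApproximation
/-- **RA-U, typed special case of [GH24] Thm 2.5.2 / [PR] Thm 7.7 / [San] Cor 3.5(iii) / [Bor09] Cor 3.13 for the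
connected reductive group `G = G_U = U(V₃,h)` over `L₀`, `S = V_∞`, followed by the projection onto the factor
`G_U(L₀,v₁) ≅ U(h^{ι₁}) ≅ U(2,1)` at the place `v₁` of `ι₁` (PerL v5 l. 672–674: "By real approximation for the connected
reductive group `G_U` ([San, Cor. 3.5(iii)], [PR, Thm. 7.7]), `Δ` is dense in `U(2,1)`"):** for every CM field `L`,
`ι₁ : L → ℂ`, hermitian 3-space `V` of signature `(2,1)` at `ι₁`, and Sylvester frame `T` at `ι₁`, the image of
`G_U(L₀) = U(h)(L₀)` under `g ↦ T⁻¹ g^{ι₁} T` (`toU21 V T hT`) is dense in `U(2,1)`.  PROVED below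
(`RealApproximation_GU_holds`, §v2). -/
def _root_.HodgeCM.Literature.RealApproximation_GU : Prop :=
  ∀ (L : CMField) (ι₁ : L →+* ℂ) (V : HermSpace3 L ι₁) (T : GL (Fin 3) ℂ)
    (hT : (T : Matrix (Fin 3) (Fin 3) ℂ)ᴴ * V.Hm.map ι₁ * (T : Matrix (Fin 3) (Fin 3) ℂ) = signatureMatrix 2),
    DenseRange (toU21 V T hT)

/-- Reading of RA-U for the consumers (`BallDictFacts.dense : Dense Δ` with `Δ := (toU21 V T hT).range`):
`RealApproximation_GU` gives `Dense ((toU21 V T hT).range : Set U21)`. -/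
theorem _root_.HodgeCM.Literature.RealApproximation_GU.dense_range (h : RealApproximation_GU)
    {L : CMField} {ι₁ : L →+* ℂ} (V : HermSpace3 L ι₁) (T : GL (Fin 3) ℂ)
    (hT : (T : Matrix (Fin 3) (Fin 3) ℂ)ᴴ * V.Hm.map ι₁ * (T : Matrix (Fin 3) (Fin 3) ℂ) = signatureMatrix 2) :
    Dense ((toU21 V T hT).range : Set HodgeCM.PerL34.BallModel.U21) := by
  have := h L ι₁ V T hT
  simpa [DenseRange, MonoidHom.coe_range] using this

/-! ## v2 — KERNEL proof of `RealApproximation_GU` (real approximation for `G_U = U(V₃,h)` at `ι₁`) -/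

/-! #### Part A — skew-hermitian approximation -/

section SkewHermitian

variable {m : Type*} [Fintype m] [DecidableEq m]

/-- The elementary skew-hermitian matrices `E(i,j;c) := c·e_{ij} − c̄·e_{ji}`. -/
def skewElem (i j : m) (c : ℂ) : Matrix m m ℂ :=
  c • Matrix.single i j (1 : ℂ) - (starRingEnd ℂ c) • Matrix.single j i (1 : ℂ)

omit [Fintype m] in
/-- (Ported verbatim from the HodgeCMPerL package; no docstring in the source.) -/
theorem skewElem_apply (i j : m) (c : ℂ) (a b : m) :
    skewElem i j c a b = (if i = a ∧ j = b then c else 0) - (if j = a ∧ i = b then starRingEnd ℂ c else 0) := by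
  simp only [skewElem, Matrix.sub_apply, Matrix.smul_apply, Matrix.single, Matrix.of_apply, smul_eq_mul, mul_ite,
    mul_one, mul_zero]

omit [Fintype m] in
/-- (Ported verbatim from the HodgeCMPerL package; no docstring in the source.) -/
theorem continuous_skewElem (i j : m) : Continuous (skewElem (m := m) i j) :=
  (continuous_id.smul continuous_const).sub (Complex.continuous_conj.smul continuous_const)

/-- A skew-hermitian matrix is the sum of the `E(i,j; y_{ij}/2)`. -/
theorem sum_skewElem_eq (Y : Matrix m m ℂ) (hY : Yᴴ = -Y) :
    ∑ i, ∑ j, skewElem i j (Y i j / 2) = Y := by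
  ext a b
  have hba : starRingEnd ℂ (Y b a) = -Y a b := by
    have := congrFun (congrFun hY a) b
    simpa [Matrix.conjTranspose_apply] using this
  simp only [Matrix.sum_apply, skewElem_apply, Finset.sum_sub_distrib, ite_and, Finset.sum_ite_eq',
    Finset.mem_univ, if_true, map_div₀, map_ofNat, hba]
  rw [Finset.sum_comm]
  simp [Finset.sum_ite_eq']
  ring

omit [Fintype m] in
/-- (Ported verbatim from the HodgeCMPerL package; no docstring in the source.) -/
theorem conjTranspose_skewElem (i j : m) (c : ℂ) : (skewElem i j c)ᴴ = -skewElem i j c := by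
  unfold skewElem
  rw [Matrix.conjTranspose_sub, Matrix.conjTranspose_smul, Matrix.conjTranspose_smul, Matrix.conjTranspose_single,
    Matrix.conjTranspose_single, star_one]
  simp only [Complex.star_def, Complex.conj_conj, neg_sub]

variable (L : CMField) (ι₁ : L →+* ℂ)

/-- The `L`-rational matrices whose `ι₁`-image is skew-hermitian (= the `σ`-skew-hermitian matrices over `L`). -/
def skewSet : Set (Matrix m m L) := {Z | (Z.map ι₁)ᴴ = -(Z.map ι₁)}

/-- Their `ι₁`-images, as an additive submonoid of the complex matrices. -/
def skewImg : AddSubmonoid (Matrix m m ℂ) where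
  carrier := (fun Z : Matrix m m L => Z.map ι₁) '' skewSet (m := m) L ι₁
  zero_mem' := ⟨0, by simp [skewSet], by simp⟩
  add_mem' := by
    rintro _ _ ⟨Z, hZ, rfl⟩ ⟨Z', hZ', rfl⟩
    refine ⟨Z + Z', ?_, Matrix.map_add ι₁ (map_add ι₁) Z Z'⟩
    simp only [skewSet, Set.mem_setOf_eq] at hZ hZ' ⊢
    rw [Matrix.map_add ι₁ (map_add ι₁), Matrix.conjTranspose_add, hZ, hZ', neg_add]

omit [Fintype m] in
/-- The `L`-rational elementary skew matrix `x e_{ij} − σ(x) e_{ji}` maps to `E(i,j; ι₁ x)`. -/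
theorem map_skewElemL (i j : m) (x : L) :
    (x • Matrix.single i j (1 : L) - (conjRingHomK L x) • Matrix.single j i (1 : L)).map ι₁ = skewElem i j (ι₁ x) := by
  ext a b
  rw [skewElem_apply]
  simp only [Matrix.map_apply, Matrix.sub_apply, Matrix.smul_apply, Matrix.single, Matrix.of_apply, smul_eq_mul,
    mul_ite, mul_one, mul_zero, map_sub, apply_ite ι₁, map_zero, embedding_conjRingHomK]

omit [Fintype m] in
/-- Every elementary skew-hermitian matrix `E(i,j;c)`, `c ∈ ℂ`, is a limit of `ι₁`-images of `L`-rational skew matrices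
(density of `ι₁(L)` in `ℂ`). -/
theorem skewElem_mem_closure (i j : m) (c : ℂ) :
    skewElem i j c ∈ closure ((skewImg (m := m) L ι₁ : AddSubmonoid (Matrix m m ℂ)) : Set (Matrix m m ℂ)) := by
  have hd : DenseRange (ι₁ : L → ℂ) := denseRange_of_isTotallyComplex L ι₁
  have hc : c ∈ closure (Set.range (ι₁ : L → ℂ)) := by rw [hd.closure_range]; trivial
  have h1 : skewElem i j c ∈ closure (skewElem i j '' Set.range (ι₁ : L → ℂ)) :=
    ContinuousWithinAt.mem_closure_image (continuous_skewElem i j).continuousWithinAt hc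
  refine closure_mono ?_ h1
  rintro _ ⟨_, ⟨x, rfl⟩, rfl⟩
  refine ⟨x • Matrix.single i j (1 : L) - (conjRingHomK L x) • Matrix.single j i (1 : L), ?_, map_skewElemL L ι₁ i j x⟩
  simp only [skewSet, Set.mem_setOf_eq, map_skewElemL, conjTranspose_skewElem]

/-- **Part A.** Every skew-hermitian complex matrix is a limit of `ι₁`-images of `L`-rational skew matrices. -/
theorem skew_mem_closure (Y : Matrix m m ℂ) (hY : Yᴴ = -Y) :
    Y ∈ closure ((skewImg (m := m) L ι₁ : AddSubmonoid (Matrix m m ℂ)) : Set (Matrix m m ℂ)) := by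
  rw [← AddSubmonoid.coe_topologicalClosure, ← sum_skewElem_eq Y hY]
  refine AddSubmonoid.sum_mem _ fun i _ => AddSubmonoid.sum_mem _ fun j _ => ?_
  have := skewElem_mem_closure (m := m) L ι₁ i j (Y i j / 2)
  rwa [← AddSubmonoid.coe_topologicalClosure] at this

end SkewHermitian


/-! #### Part B — the Lie algebra `𝔲(h)`: `L₀`-points are dense in the real points -/

section Lie

variable {m : Type*} [Fintype m] [DecidableEq m] (L : CMField) (ι₁ : L →+* ℂ) (Hm : Matrix m m L)

/-- The `L`-rational matrices whose `ι₁`-image lies in `𝔲(h^{ι₁}) = {X : Xᴴ h + h X = 0}` (= `Lie U(h)(L₀)`). -/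
def lieSet : Set (Matrix m m L) := {Y | (Y.map ι₁)ᴴ * Hm.map ι₁ + Hm.map ι₁ * Y.map ι₁ = 0}

/-- **Part B.** For `h^{ι₁}` hermitian and invertible, every `X ∈ 𝔲(h^{ι₁})` is a limit of `ι₁`-images of elements of
`Lie U(h)(L₀)`: `X = W h^{ι₁}` with `W = X (h^{ι₁})⁻¹` skew-hermitian, and `W` is such a limit by Part A. -/
theorem lie_mem_closure (hH : (Hm.map ι₁)ᴴ = Hm.map ι₁) (hdet : IsUnit (Hm.map ι₁).det) (X : Matrix m m ℂ)
    (hX : Xᴴ * Hm.map ι₁ + Hm.map ι₁ * X = 0) :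
    X ∈ closure ((fun Y : Matrix m m L => Y.map ι₁) '' lieSet (m := m) L ι₁ Hm) := by
  set Hc := Hm.map ι₁ with hHc
  set W := X * Hc⁻¹ with hW
  have hXH : Xᴴ * Hc = -(Hc * X) := eq_neg_of_add_eq_zero_left hX
  have hWskew : Wᴴ = -W := by
    rw [hW, Matrix.conjTranspose_mul, Matrix.conjTranspose_nonsing_inv, hH]
    -- `Hc⁻¹ Xᴴ = -(X Hc⁻¹)`: multiply `Xᴴ Hc = -Hc X` by `Hc⁻¹` on both sides
    have h1 : Hc⁻¹ * (Xᴴ * Hc) * Hc⁻¹ = Hc⁻¹ * (-(Hc * X)) * Hc⁻¹ := by rw [hXH]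
    have h2 : Hc⁻¹ * (Xᴴ * Hc) * Hc⁻¹ = Hc⁻¹ * Xᴴ := by
      rw [Matrix.mul_assoc, Matrix.mul_assoc, Matrix.mul_nonsing_inv _ hdet, Matrix.mul_one]
    have h3 : Hc⁻¹ * (-(Hc * X)) * Hc⁻¹ = -(X * Hc⁻¹) := by
      rw [Matrix.mul_neg, Matrix.neg_mul, ← Matrix.mul_assoc, Matrix.nonsing_inv_mul _ hdet, Matrix.one_mul]
    rw [← h2, h1, h3]
  have hWc : W ∈ closure ((skewImg (m := m) L ι₁ : AddSubmonoid (Matrix m m ℂ)) : Set (Matrix m m ℂ)) :=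
    skew_mem_closure L ι₁ W hWskew
  -- right multiplication by `Hc` is continuous and takes `W` to `X`
  have hR : Continuous fun M : Matrix m m ℂ => M * Hc := continuous_id.mul continuous_const
  have hX' : X = W * Hc := by
    rw [hW, Matrix.mul_assoc, Matrix.nonsing_inv_mul _ hdet, Matrix.mul_one]
  have hmem : W * Hc ∈ closure ((fun M : Matrix m m ℂ => M * Hc) '' ((skewImg (m := m) L ι₁ : AddSubmonoid _) : Set _)) :=
    ContinuousWithinAt.mem_closure_image hR.continuousWithinAt hWc
  rw [hX']
  refine closure_mono ?_ hmem
  rintro _ ⟨_, ⟨Z, hZ, rfl⟩, rfl⟩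
  refine ⟨Z * Hm, ?_, by simp only [Matrix.map_mul, hHc]⟩
  simp only [lieSet, skewSet, Set.mem_setOf_eq] at hZ ⊢
  rw [Matrix.map_mul, Matrix.conjTranspose_mul, hZ, ← hHc, hH]
  simp only [Matrix.neg_mul, Matrix.mul_assoc, Matrix.mul_neg, neg_add_cancel]

end Lie

/-! #### Part C — the Cayley transform (over `ℂ`) -/

section Cayley

variable {m : Type*} [Fintype m] [DecidableEq m]

/-- Cayley: for `X ∈ 𝔲(H)` with `1 + X` invertible and `|α| = 1`, `u = α (1−X)(1+X)⁻¹` preserves `H`. -/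
theorem cayley_mem {Hc X : Matrix m m ℂ} (hX : Xᴴ * Hc + Hc * X = 0) (h1 : IsUnit (1 + X).det) {α : ℂ}
    (hα : starRingEnd ℂ α * α = 1) :
    (α • ((1 - X) * (1 + X)⁻¹))ᴴ * Hc * (α • ((1 - X) * (1 + X)⁻¹)) = Hc := by
  have hXH : Xᴴ * Hc = -(Hc * X) := eq_neg_of_add_eq_zero_left hX
  have k1 : (1 - Xᴴ) * Hc = Hc * (1 + X) := by
    rw [Matrix.sub_mul, Matrix.one_mul, hXH, Matrix.mul_add, Matrix.mul_one, sub_neg_eq_add]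
  have k2 : Hc * (1 - X) = (1 + Xᴴ) * Hc := by
    rw [Matrix.mul_sub, Matrix.mul_one, Matrix.add_mul, Matrix.one_mul, hXH, sub_eq_add_neg]
  have h1' : IsUnit (1 + Xᴴ).det := by
    have : (1 + Xᴴ) = (1 + X)ᴴ := by rw [Matrix.conjTranspose_add, Matrix.conjTranspose_one]
    rw [this, Matrix.det_conjTranspose]
    exact h1.star
  have hcomm : (1 + X) * (1 - X) = (1 - X) * (1 + X) := by
    simp only [Matrix.mul_sub, Matrix.sub_mul, Matrix.mul_one, Matrix.one_mul, Matrix.mul_add, Matrix.add_mul]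
    abel
  rw [Matrix.conjTranspose_smul, Matrix.conjTranspose_mul, Matrix.conjTranspose_nonsing_inv,
    Matrix.conjTranspose_sub, Matrix.conjTranspose_add, Matrix.conjTranspose_one]
  rw [Matrix.smul_mul, Matrix.smul_mul, Matrix.mul_smul, smul_smul, Complex.star_def, hα, one_smul]
  calc (1 + Xᴴ)⁻¹ * (1 - Xᴴ) * Hc * ((1 - X) * (1 + X)⁻¹)
      = (1 + Xᴴ)⁻¹ * ((1 - Xᴴ) * Hc) * (1 - X) * (1 + X)⁻¹ := by simp only [Matrix.mul_assoc]
    _ = (1 + Xᴴ)⁻¹ * Hc * ((1 + X) * (1 - X)) * (1 + X)⁻¹ := by rw [k1]; simp only [Matrix.mul_assoc]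
    _ = (1 + Xᴴ)⁻¹ * Hc * (1 - X) * ((1 + X) * (1 + X)⁻¹) := by rw [hcomm]; simp only [Matrix.mul_assoc]
    _ = (1 + Xᴴ)⁻¹ * (Hc * (1 - X)) := by rw [Matrix.mul_nonsing_inv _ h1, Matrix.mul_one, Matrix.mul_assoc]
    _ = (1 + Xᴴ)⁻¹ * (1 + Xᴴ) * Hc := by rw [k2, Matrix.mul_assoc]
    _ = Hc := by rw [Matrix.nonsing_inv_mul _ h1', Matrix.one_mul]

/-- Inverse Cayley, part (i): for `u ∈ U(H)` and `|α| = 1` with `A = α + u` invertible, `X = (α+u)⁻¹(α−u)` lies in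
`𝔲(H)`.  Proof: `Aᴴ (Xᴴ H + H X) A = Bᴴ H A + Aᴴ H B = 2|α|² H − 2 uᴴ H u = 0` (`B = α − u`, `XA = B`). -/
theorem cayleyInv_mem_lie {Hc u : Matrix m m ℂ} (hu : uᴴ * Hc * u = Hc) {α : ℂ} (hα : starRingEnd ℂ α * α = 1)
    (hA : IsUnit (α • (1 : Matrix m m ℂ) + u).det) :
    ((α • (1 : Matrix m m ℂ) + u)⁻¹ * (α • 1 - u))ᴴ * Hc + Hc * ((α • (1 : Matrix m m ℂ) + u)⁻¹ * (α • 1 - u)) = 0 := by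
  set A : Matrix m m ℂ := α • 1 + u with hAd
  set B : Matrix m m ℂ := α • 1 - u with hBd
  set X : Matrix m m ℂ := A⁻¹ * B with hXd
  have hAB : A * B = B * A := by
    simp only [hAd, hBd, Matrix.mul_sub, Matrix.sub_mul, Matrix.mul_add, Matrix.add_mul, Matrix.smul_mul,
      Matrix.mul_smul, Matrix.one_mul, Matrix.mul_one, smul_add, smul_sub, smul_smul]
    abel
  have hXA : X * A = B := by
    rw [hXd, Matrix.mul_assoc, ← hAB, ← Matrix.mul_assoc, Matrix.nonsing_inv_mul _ hA, Matrix.one_mul]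
  have hAX : Aᴴ * Xᴴ = Bᴴ := by rw [← Matrix.conjTranspose_mul, hXA]
  -- the core identity
  have hcore : Bᴴ * Hc * A + Aᴴ * Hc * B = 0 := by
    have hP : uᴴ * Hc * u = Hc := hu
    have hα' : α * starRingEnd ℂ α = 1 := by rw [mul_comm]; exact hα
    simp only [hAd, hBd, Matrix.conjTranspose_add, Matrix.conjTranspose_sub, Matrix.conjTranspose_smul,
      Matrix.conjTranspose_one, Complex.star_def]
    simp only [Matrix.add_mul, Matrix.sub_mul, Matrix.mul_add, Matrix.mul_sub, Matrix.smul_mul, Matrix.mul_smul,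
      Matrix.one_mul, Matrix.mul_one, smul_add, smul_sub, smul_smul, hP, hα', one_smul]
    abel
  have hconj : Aᴴ * (Xᴴ * Hc + Hc * X) * A = 0 := by
    calc Aᴴ * (Xᴴ * Hc + Hc * X) * A = (Aᴴ * Xᴴ) * Hc * A + Aᴴ * Hc * (X * A) := by
          simp only [Matrix.mul_add, Matrix.add_mul, Matrix.mul_assoc]
      _ = 0 := by rw [hAX, hXA, hcore]
  -- cancel the invertible `Aᴴ`, `A`
  have hA' : IsUnit Aᴴ.det := by rw [Matrix.det_conjTranspose]; exact hA.star
  have : Xᴴ * Hc + Hc * X = Aᴴ⁻¹ * (Aᴴ * (Xᴴ * Hc + Hc * X) * A) * A⁻¹ := by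
    rw [Matrix.mul_assoc Aᴴ, ← Matrix.mul_assoc Aᴴ⁻¹, Matrix.nonsing_inv_mul _ hA', Matrix.one_mul,
      Matrix.mul_assoc, Matrix.mul_nonsing_inv _ hA, Matrix.mul_one]
  rw [this, hconj, Matrix.mul_zero, Matrix.zero_mul]

/-- Inverse Cayley, parts (ii)–(iii): with `A = α + u` invertible and `α ≠ 0`, `X = A⁻¹(α − u)` has `1 + X = 2α A⁻¹`
invertible and `α (1−X)(1+X)⁻¹ = u`. -/
theorem cayleyInv_eq {u : Matrix m m ℂ} {α : ℂ} (hα0 : α ≠ 0) (hA : IsUnit (α • (1 : Matrix m m ℂ) + u).det) :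
    IsUnit (1 + (α • (1 : Matrix m m ℂ) + u)⁻¹ * (α • 1 - u)).det ∧
      α • ((1 - (α • (1 : Matrix m m ℂ) + u)⁻¹ * (α • 1 - u)) * (1 + (α • (1 : Matrix m m ℂ) + u)⁻¹ * (α • 1 - u))⁻¹) = u := by
  set A : Matrix m m ℂ := α • 1 + u with hAd
  set B : Matrix m m ℂ := α • 1 - u with hBd
  have h2α : (2 * α) ≠ 0 := mul_ne_zero two_ne_zero hα0
  have hApB : A + B = (2 * α) • (1 : Matrix m m ℂ) := by
    rw [hAd, hBd, mul_smul, two_smul]; abel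
  have hAmB : A - B = (2 : ℂ) • u := by
    rw [hAd, hBd, two_smul]; abel
  have hA1 : A⁻¹ * A = 1 := Matrix.nonsing_inv_mul _ hA
  have h1X : 1 + A⁻¹ * B = (2 * α) • A⁻¹ := by
    calc 1 + A⁻¹ * B = A⁻¹ * A + A⁻¹ * B := by rw [hA1]
      _ = A⁻¹ * (A + B) := (Matrix.mul_add _ _ _).symm
      _ = (2 * α) • A⁻¹ := by rw [hApB, Matrix.mul_smul, Matrix.mul_one]
  have h1X' : 1 - A⁻¹ * B = (2 : ℂ) • (A⁻¹ * u) := by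
    calc 1 - A⁻¹ * B = A⁻¹ * A - A⁻¹ * B := by rw [hA1]
      _ = A⁻¹ * (A - B) := (Matrix.mul_sub _ _ _).symm
      _ = (2 : ℂ) • (A⁻¹ * u) := by rw [hAmB, Matrix.mul_smul]
  have hunit : IsUnit (1 + A⁻¹ * B).det := by
    rw [h1X, Matrix.det_smul]
    exact (IsUnit.pow _ (isUnit_iff_ne_zero.mpr h2α)).mul (Matrix.isUnit_nonsing_inv_det _ hA)
  refine ⟨hunit, ?_⟩
  -- `(1 + X)⁻¹ = (2α)⁻¹ A`
  have hinv : (1 + A⁻¹ * B)⁻¹ = (2 * α)⁻¹ • A := by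
    rw [h1X]
    apply Matrix.inv_eq_left_inv
    rw [Matrix.smul_mul, Matrix.mul_smul, smul_smul, inv_mul_cancel₀ h2α, one_smul, Matrix.mul_nonsing_inv _ hA]
  have huA : u * A = A * u := by
    simp only [hAd, Matrix.mul_add, Matrix.add_mul, Matrix.mul_smul, Matrix.smul_mul, Matrix.mul_one, Matrix.one_mul]
  rw [hinv, h1X', Matrix.smul_mul, Matrix.mul_smul, smul_smul, smul_smul, Matrix.mul_assoc, huA, ← Matrix.mul_assoc,
    Matrix.nonsing_inv_mul _ hA, Matrix.one_mul]
  have : α * 2 * (2 * α)⁻¹ = 1 := by field_simp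
  rw [this, one_smul]

end Cayley

/-! #### Part D — a unit scalar `α = ι₁(a)`, `a ∈ U(1)(L₀)`, with `α + u` invertible -/

section Alpha

variable (L : CMField) (ι₁ : L →+* ℂ)

/-- (Ported verbatim from the HodgeCMPerL package; no docstring in the source.) -/
theorem conj_mul_of_mem_normOne {a : L} (ha : a ∈ normOne L) : starRingEnd ℂ (ι₁ a) * ι₁ a = 1 := by
  rw [mem_normOne_iff] at ha
  rw [mul_comm, ← embedding_conjRingHomK L ι₁, ← map_mul, ha, map_one]

/-- (Ported verbatim from the HodgeCMPerL package; no docstring in the source.) -/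
theorem ne_zero_of_mem_normOne {a : L} (ha : a ∈ normOne L) : ι₁ a ≠ 0 := by
  intro h0
  have := conj_mul_of_mem_normOne L ι₁ ha
  rw [h0, mul_zero] at this
  exact zero_ne_one this

/-- There is an `x ∈ L` with `ι₁ x ∉ ℝ` (the CM field `L` is totally complex). -/
theorem exists_im_ne_zero : ∃ x : L, (ι₁ x).im ≠ 0 := by
  have h : ¬ ComplexEmbedding.IsReal ι₁ := IsTotallyComplex.complexEmbedding_not_isReal ι₁
  rw [ComplexEmbedding.isReal_iff] at h
  by_contra hall
  simp only [not_exists, ne_eq, not_not] at hall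
  apply h
  ext x
  rw [ComplexEmbedding.conjugate_coe_eq]
  exact Complex.conj_eq_iff_im.mpr (hall x)

/-- The candidates `a_q = w_q / σ(w_q)`, `w_q = 1 + q x`: their `ι₁`-images `(1 + q t)/(1 + q t̄)` are pairwise distinct. -/
theorem infinite_normOne_image : (ι₁ '' normOne L).Infinite := by
  obtain ⟨x, hx⟩ := exists_im_ne_zero L ι₁
  set t : ℂ := ι₁ x with ht
  have hσ : ∀ y : L, conjRingHomK L (conjRingHomK L y) = y := fun y => IsCMField.complexConj_apply_apply L y
  -- `w q ≠ 0`
  have hw : ∀ q : ℕ, ι₁ (1 + (q : L) * x) = 1 + (q : ℂ) * t := by intro q; simp [ht]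
  have hw0 : ∀ q : ℕ, (1 : ℂ) + (q : ℂ) * t ≠ 0 := by
    intro q h0
    have him := congrArg Complex.im h0
    simp only [Complex.add_im, Complex.one_im, Complex.mul_im, Complex.natCast_re, Complex.natCast_im, zero_mul,
      add_zero, zero_add, Complex.zero_im] at him
    rcases mul_eq_zero.mp him with hq | hq
    · have hq' : (q : ℂ) = 0 := by exact_mod_cast hq
      rw [hq', zero_mul, add_zero] at h0
      exact one_ne_zero h0
    · exact hx hq
  have hwc0 : ∀ q : ℕ, (1 : ℂ) + (q : ℂ) * starRingEnd ℂ t ≠ 0 := by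
    intro q h0
    apply hw0 q
    have := congrArg (starRingEnd ℂ) h0
    simpa using this
  have hwL0 : ∀ q : ℕ, (1 : L) + (q : L) * x ≠ 0 := by
    intro q h0
    apply hw0 q
    rw [← hw q, h0, map_zero]
  let f : ℕ → ℂ := fun q => (1 + (q : ℂ) * t) / (1 + (q : ℂ) * starRingEnd ℂ t)
  have hf : ∀ q : ℕ, f q ∈ ι₁ '' normOne L := by
    intro q
    refine ⟨(1 + (q : L) * x) / conjRingHomK L (1 + (q : L) * x), div_conj_mem_normOne L (hwL0 q), ?_⟩
    simp only [f, map_div₀, embedding_conjRingHomK, hw q, map_add, map_one, map_mul, map_natCast, ← ht]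
  have hinj : Function.Injective f := by
    intro q q' hqq
    simp only [f] at hqq
    rw [div_eq_div_iff (hwc0 q) (hwc0 q')] at hqq
    have h1 : ((q : ℂ) - q') * (t - starRingEnd ℂ t) = 0 := by linear_combination hqq
    rcases mul_eq_zero.mp h1 with h | h
    · exact_mod_cast sub_eq_zero.mp h
    · exfalso
      apply hx
      have : starRingEnd ℂ t = t := (sub_eq_zero.mp h).symm
      exact Complex.conj_eq_iff_im.mp this
  exact Set.infinite_of_injective_forall_mem hinj hf

variable {m : Type*} [Fintype m] [DecidableEq m]

/-- **Part D.** For every complex matrix `u` there is `a ∈ U(1)(L₀)` with `ι₁(a)·1 + u` invertible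
(`z ↦ det(z·1 + u)` is the characteristic polynomial of `−u`, which has finitely many roots). -/
theorem exists_normOne_isUnit (u : Matrix m m ℂ) :
    ∃ a : L, a ∈ normOne L ∧ IsUnit (ι₁ a • (1 : Matrix m m ℂ) + u).det := by
  classical
  have hfin : {z : ℂ | Polynomial.IsRoot (-u).charpoly z}.Finite :=
    Polynomial.finite_setOf_isRoot (Matrix.charpoly_monic (-u)).ne_zero
  obtain ⟨z, ⟨a, ha, rfl⟩, hz⟩ := (infinite_normOne_image L ι₁).exists_notMem_finite hfin
  refine ⟨a, ha, isUnit_iff_ne_zero.mpr ?_⟩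
  intro h0
  apply hz
  simp only [Set.mem_setOf_eq, Polynomial.IsRoot.def, Matrix.eval_charpoly, Matrix.scalar_apply,
    ← Matrix.smul_one_eq_diagonal, sub_neg_eq_add]
  exact h0

end Alpha

/-! #### Part E — `ι₁(U(h)(L₀))` is dense in `U(h^{ι₁})` (matrix level) -/

section MatrixDensity

variable (L : CMField) (ι₁ : L →+* ℂ) {m : Type*} [Fintype m] [DecidableEq m]

omit [Fintype m] [DecidableEq m] in
/-- Base change of the `σ`-conjugate transpose along `ι₁` (general size). -/
theorem conjTranspose_map_eq' (g : Matrix m m L) :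
    (g.map ι₁)ᴴ = ((g.map (conjRingHomK L))ᵀ).map ι₁ := by
  ext i j
  simp [Matrix.conjTranspose_apply, Matrix.map_apply, Matrix.transpose_apply, embedding_conjRingHomK]

/-- Along `ι₁`, the inverse of an invertible `L`-matrix maps to the inverse. -/
theorem map_nonsing_inv_eq (A : Matrix m m L) (hA : IsUnit A.det) : (A⁻¹).map ι₁ = (A.map ι₁)⁻¹ := by
  symm
  apply Matrix.inv_eq_left_inv
  rw [← Matrix.map_mul, Matrix.nonsing_inv_mul _ hA, Matrix.map_one ι₁ (map_zero ι₁) (map_one ι₁)]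


-- port_pkg: scope closed for this part
end MatrixDensity
end RealApproximation
end HodgeCM.Literature
end
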